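import Literature.Computability.Complexity.ProbabilisticClasses
import Mathlib.Logic.Equiv.Fin.Basic
import Mathlib.Data.List.OfFn
import Mathlib.Data.List.GetD
import HarnessLib

/-!
# `PP ⊆ PostBQP`, II: the shifted gap of a `PP` witness and the base counting predicate

Topic `Literature/Computability/QuantumComplexity`; second file of the series proving Aaronson's
`PP ⊆ PostBQP` (Proc. R. Soc. A 461 (2005), Thm. 4, arXiv:quant-ph/0412187 pp. 5–6) in the
tree's model, see `PPPostBQPScales.lean` for the plan. Aaronson starts from "an efficiently
computable Boolean function `f : {0,1}^n → {0,1}` with `s = |f⁻¹(1)|`; we need to decide whether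
`s < 2^{n-1}` or `s ≥ 2^{n-1}`. (As a technicality, we can guarantee using padding that `s > 0`.)"
In the tree `PP = pMajority P` (Gill's strict majority: `x ∈ L ↔ 1/2 < Pr_y[⟨x,y⟩ ∈ R]` over
the `2^m` coin strings `y` of length `m = p(|x|)`, `Complexity/ProbabilisticClasses.lean`), and
the padding technicality is realised here once and for all by a fixed predicate transformation:

* `sgn b = (-1)^b ∈ ℤ` and the splitting of sums over `{0,1}^{a+b}` along `List.ofFn`
  (`sum_fin_add`, `sum_fin_succ`, `sum_fin_three`) used throughout the series;
* `accCount R p x = s_x = #{y ∈ {0,1}^m | ⟨x,y⟩ ∈ R}` and the **shifted gap**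
  `gapG R p x = 4 s_x - 2^{m+1} - 1 = 2(2 s_x - 2^m) - 1`, which is odd (`gapG_ne_zero`), bounded
  by `2^{m+1} + 1` (`abs_gapG_le`), positive iff `x ∈ L` and negative iff `x ∉ L` for a `PP`
  witness `(R, p)` of `L` (`gapG_pos_iff`, `gapG_neg_iff`, through `uniformProb_eq_accCount`);
* the **base predicate** `baseBit R p x` on `m + 3` coins `y b₁ b₂ b₃`: `[⟨x,y⟩ ∉ R]` if
  `b₁ = 0`; `b₃` if `b₁ = 1`, except that the single string `y = 0^m, b₂ = b₃ = 0` is accepted —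
  whose gap `Σ (-1)^{baseBit} = 2 · gapG R p x` (`sum_sgn_baseBit`) is the nonzero odd multiple of
  the majority gap that the product test of file I needs (`G ≠ 0`).

The scaled block predicates built on `baseBit` and their gaps are in the sequel
(`PPPostBQPBlocks.lean`).

## References

* S. Aaronson, *Quantum computing, postselection, and probabilistic polynomial-time*, Proc. R.
  Soc. A 461 (2005) 3473–3482, arXiv:quant-ph/0412187: Thm. 4 and its proof (p. 5: `s`,
  the padding technicality).
* J. Gill, *Computational complexity of probabilistic Turing machines*, SIAM J. Comput. 6 (1977),
  Def. 5.1 (`PP`, strict majority).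
-/

namespace Literature.Computability.QuantumComplexity

namespace PPPostBQP

open Finset Complexity _root_.Computability

/-! ### Signs and sums over bit strings -/

/-- The sign `(-1)^b` of a bit, as an INTEGER (the gaps of this series are exact integer
counts; the tree's real- and complex-valued variants `Literature.Probability.RandomGraphs.sgn`,
`JonesSamplerAnalysis`'s `sgn`, `RazTalBlocks`'s `sgnC`, `ShallowCircuitsProofs`'s `BGK.sgn` are
the casts of this one). [folklore] -/
def sgn (b : Bool) : ℤ := if b then -1 else 1

/-- `sgn 1 = -1`. [folklore] -/
@[simp] theorem sgn_true : sgn true = -1 := rfl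

/-- `sgn 0 = 1`. [folklore] -/
@[simp] theorem sgn_false : sgn false = 1 := rfl

/-- `sgn` is multiplicative for `XOR`. [folklore] -/
theorem sgn_xor (a b : Bool) : sgn (a ^^ b) = sgn a * sgn b := by
  cases a <;> cases b <;> rfl

/-- The two signs cancel. [folklore] -/
theorem sum_sgn : ∑ b : Bool, sgn b = 0 := by
  simp [sgn]

/-- `sgn b ^ 2 = 1`. [folklore] -/
@[simp] theorem sgn_sq (b : Bool) : sgn b ^ 2 = 1 := by
  cases b <;> rfl

/-- `sgn` of a decision is `±1` according to the proposition. [folklore] -/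
theorem sgn_decide (P : Prop) [Decidable P] : sgn (decide P) = if P then -1 else 1 := by
  by_cases h : P <;> simp [sgn, h]

/-- **Splitting a sum over `{0,1}^{a+b}`**: first `a` bits, then `b` bits (`Fin.appendEquiv`);
read through `List.ofFn` with `List.ofFn_fin_append`. [folklore] -/
theorem sum_fin_add {α : Type*} [AddCommMonoid α] (a b : ℕ) (F : (Fin (a + b) → Bool) → α) :
    ∑ v : Fin (a + b) → Bool, F v = ∑ u : Fin a → Bool, ∑ w : Fin b → Bool, F (Fin.append u w) := by
  rw [← (Fin.appendEquiv a b).sum_comp, Fintype.sum_prod_type]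
  rfl

/-- **Peeling the last bit** of a sum over `{0,1}^{a+1}`. [folklore] -/
theorem sum_fin_succ {α : Type*} [AddCommMonoid α] (a : ℕ) (F : (Fin (a + 1) → Bool) → α) :
    ∑ v : Fin (a + 1) → Bool, F v = ∑ u : Fin a → Bool, ∑ b : Bool, F (Fin.append u fun _ => b) := by
  rw [sum_fin_add]
  refine Finset.sum_congr rfl fun u _ => Fintype.sum_equiv (Equiv.funUnique (Fin 1) Bool) _ _ fun w => ?_
  change F (Fin.append u w) = F (Fin.append u fun _ => w default)
  congr 2
  funext i
  rw [Subsingleton.elim i default]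

/-- The list of a constant bit on `Fin 1`. [folklore] -/
@[simp] theorem ofFn_const_fin_one (b : Bool) : List.ofFn (fun _ : Fin 1 => b) = [b] := rfl

/-- The list of a string on `Fin 0`. [folklore] -/
theorem ofFn_fin_zero (e : Fin 0 → Bool) : List.ofFn e = [] := rfl

/-- A sum over `{0,1}^3`, bit by bit, read through `List.ofFn`. [folklore] -/
theorem sum_fin_three {α : Type*} [AddCommMonoid α] (g : List Bool → α) :
    ∑ w : Fin 3 → Bool, g (List.ofFn w) = ∑ b₁ : Bool, ∑ b₂ : Bool, ∑ b₃ : Bool, g [b₁, b₂, b₃] := by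
  rw [sum_fin_succ, sum_fin_succ, sum_fin_succ, Fintype.sum_unique]
  simp only [List.ofFn_fin_append, ofFn_const_fin_one, ofFn_fin_zero, List.nil_append,
    List.cons_append]

/-- `Σ_{y} (if P y then -1 else 1) = 2^k - 2 #P` over `{0,1}^k`, in the form
`Σ sgn = #¬P - #P`: counting both sides of a predicate. [folklore] -/
theorem sum_ite_neg_one_one {k : ℕ} (P : (Fin k → Bool) → Prop) [DecidablePred P] :
    ∑ y : Fin k → Bool, (if P y then (-1 : ℤ) else 1) =
      (2 : ℤ) ^ k - 2 * ((univ.filter P).card : ℤ) := by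
  rw [Finset.sum_ite, sum_const, sum_const, nsmul_eq_mul, nsmul_eq_mul]
  have h := Finset.card_filter_add_card_filter_not (s := (univ : Finset (Fin k → Bool))) P
  rw [card_univ, Fintype.card_fun, Fintype.card_bool, Fintype.card_fin] at h
  have h' : (((univ : Finset (Fin k → Bool)).filter fun y => ¬ P y).card : ℤ) =
      (2 : ℤ) ^ k - ((univ.filter P).card : ℤ) := by
    rw [eq_sub_iff_add_eq', ← Nat.cast_add, h]; simp
  rw [h']; ring

/-! ### The shifted gap of a `PP` witness -/

section Gap

variable (R : Language Bool) (p : Polynomial ℕ)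

/-- `s_x`: the number of coin strings `y ∈ {0,1}^{p |x|}` with `⟨x, y⟩ ∈ R` (Aaronson's `s`, for
the predicate `y ↦ [⟨x,y⟩ ∈ R]` of a `PP` witness). [cite: Aaronson2005, Thm. 4 (proof)] -/
noncomputable def accCount (x : List Bool) : ℕ := by
  classical
  exact ((univ : Finset (Fin (p.eval x.length) → Bool)).filter
    fun y => boolPair x (List.ofFn y) ∈ R).card

/-- **The shifted gap** `G_x = 4 s_x - 2^{m+1} - 1 = 2 (2 s_x - 2^m) - 1` (`m = p |x|`): an odd
integer with the sign of the strict-majority gap `2 s_x - 2^m` (ties counted negative) — the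
tree's rendering of Aaronson's padding technicality. [cite: Aaronson2005, Thm. 4 (proof)] -/
noncomputable def gapG (x : List Bool) : ℤ :=
  4 * (accCount R p x : ℤ) - 2 ^ (p.eval x.length + 1) - 1

variable {R p}

/-- `s_x ≤ 2^m`. [folklore] -/
theorem accCount_le (x : List Bool) : accCount R p x ≤ 2 ^ p.eval x.length := by
  classical
  unfold accCount
  exact (card_le_univ _).trans (by rw [Fintype.card_fun, Fintype.card_bool, Fintype.card_fin])

/-- The shifted gap is odd, hence nonzero. [folklore] -/
theorem gapG_ne_zero (x : List Bool) : gapG R p x ≠ 0 := by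
  unfold gapG
  rw [pow_succ]
  omega

/-- `|G_x| ≤ 2^{m+1} + 1`. [folklore] -/
theorem abs_gapG_le (x : List Bool) : |gapG R p x| ≤ 2 ^ (p.eval x.length + 1) + 1 := by
  have h := accCount_le (R := R) (p := p) x
  have h' : (accCount R p x : ℤ) ≤ 2 ^ p.eval x.length := by exact_mod_cast h
  unfold gapG
  rw [abs_le, pow_succ]
  constructor <;> nlinarith [h', Nat.cast_nonneg (α := ℤ) (accCount R p x)]

/-- The coin-counting probability of `PP` is `s_x / 2^m`: Mathlib's `List.Vector Bool m` versus
`Fin m → Bool` (`Equiv.vectorEquivFin`). [folklore] -/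
theorem uniformProb_eq_accCount (x : List Bool) :
    uniformProb (p.eval x.length) {y | boolPair x y ∈ R} =
      (accCount R p x : ℝ) / 2 ^ p.eval x.length := by
  classical
  unfold uniformProb accCount
  congr 2
  refine Finset.card_equiv (Equiv.vectorEquivFin Bool (p.eval x.length)) fun v => ?_
  simp only [Finset.mem_filter, Finset.mem_univ, true_and, Set.mem_setOf_eq]
  have hv : List.ofFn ((Equiv.vectorEquivFin Bool (p.eval x.length)) v) = v.toList := by
    change List.ofFn v.get = v.toList
    rw [← List.Vector.toList_ofFn, List.Vector.ofFn_get]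
  rw [hv]

/-- **Membership as the sign of the shifted gap**, for a `PP` witness `(R, p)` of `L`:
`x ∈ L ↔ 0 < G_x`. [cite: Gill1977, Def. 5.1] -/
theorem gapG_pos_iff {L : Language Bool} {x : List Bool}
    (hw : x ∈ L ↔ 1 / 2 < uniformProb (p.eval x.length) {y | boolPair x y ∈ R}) :
    x ∈ L ↔ 0 < gapG R p x := by
  rw [hw, uniformProb_eq_accCount, lt_div_iff₀ (by positivity), gapG, pow_succ]
  constructor
  · intro h
    have h2 : (2 : ℝ) ^ p.eval x.length < 2 * accCount R p x := by linarith
    have h3 : (2 : ℤ) ^ p.eval x.length < 2 * accCount R p x := by exact_mod_cast h2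
    omega
  · intro h
    have h3 : (2 : ℤ) ^ p.eval x.length < 2 * accCount R p x := by omega
    have h2 : (2 : ℝ) ^ p.eval x.length < 2 * accCount R p x := by exact_mod_cast h3
    linarith

/-- Dually `x ∉ L ↔ G_x < 0` (the gap is never `0`). [cite: Gill1977, Def. 5.1] -/
theorem gapG_neg_iff {L : Language Bool} {x : List Bool}
    (hw : x ∈ L ↔ 1 / 2 < uniformProb (p.eval x.length) {y | boolPair x y ∈ R}) :
    x ∉ L ↔ gapG R p x < 0 := by
  rw [gapG_pos_iff hw, not_lt]
  exact ⟨fun h => lt_of_le_of_ne h (gapG_ne_zero x), le_of_lt⟩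

open Classical in
/-- `sgn` of a negated Boolean indicator: `+1` on members, `-1` off. [folklore] -/
theorem sgn_not_boolIndicator (S : Language Bool) (w : List Bool) :
    sgn (!S.boolIndicator w) = if w ∈ S then 1 else -1 := by
  by_cases h : w ∈ S
  · rw [if_pos h, (Set.mem_iff_boolIndicator (s := S) w).1 h]; rfl
  · rw [if_neg h, (Set.notMem_iff_boolIndicator (s := S) w).1 h]; rfl

/-- `Σ_y (-1)^{[⟨x,y⟩ ∉ R]} = 2 s_x - 2^m` (the majority gap). [cite: Aaronson2005, Thm. 4 (proof)] -/
theorem sum_sgn_not_boolIndicator (x : List Bool) :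
    ∑ y : Fin (p.eval x.length) → Bool, sgn (!R.boolIndicator (boolPair x (List.ofFn y))) =
      2 * (accCount R p x : ℤ) - 2 ^ p.eval x.length := by
  classical
  simp_rw [sgn_not_boolIndicator]
  have h : ∀ y : Fin (p.eval x.length) → Bool, (if boolPair x (List.ofFn y) ∈ R then (1 : ℤ) else -1) =
      if boolPair x (List.ofFn y) ∉ R then (-1 : ℤ) else 1 := fun y => by
    by_cases hy : boolPair x (List.ofFn y) ∈ R <;> simp [hy]
  simp_rw [h]
  rw [sum_ite_neg_one_one]
  have hc : ((univ.filter fun y : Fin (p.eval x.length) → Bool => boolPair x (List.ofFn y) ∉ R).card : ℤ)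
      = (2 : ℤ) ^ p.eval x.length - accCount R p x := by
    have h2 := Finset.card_filter_add_card_filter_not
      (s := (univ : Finset (Fin (p.eval x.length) → Bool))) (fun y => boolPair x (List.ofFn y) ∈ R)
    rw [card_univ, Fintype.card_fun, Fintype.card_bool, Fintype.card_fin] at h2
    unfold accCount
    rw [eq_sub_iff_add_eq', ← Nat.cast_add]
    exact_mod_cast h2
  rw [hc]; ring

end Gap

/-! ### The base predicate and its gap -/

section Base

variable (R : Language Bool) (p : Polynomial ℕ)

/-- **The base predicate** on `m + 3` coins `y b₁ b₂ b₃` (`m = p |x|`, `y` the first `m` coins):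
if `b₁ = 0` it is `[⟨x,y⟩ ∉ R]` (negated `Set.boolIndicator`); if `b₁ = 1` it is `b₃`, except that the string `y = 0^m`,
`b₂ = b₃ = 0` evaluates to `1`. Its gap is `4 (2 s_x - 2^m) - 2 = 2 G_x` (`sum_sgn_baseBit`).
Out-of-format strings are read through `List.take`/`List.getD` (junk convention, never met).
[cite: Aaronson2005, Thm. 4 (proof: the padding technicality)] -/
noncomputable def baseBit (x yt : List Bool) : Bool :=
  if yt.getD (p.eval x.length) false then
    ((yt.take (p.eval x.length)).all (fun b => !b) && !(yt.getD (p.eval x.length + 1) false) &&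
        !(yt.getD (p.eval x.length + 2) false)) || yt.getD (p.eval x.length + 2) false
  else !R.boolIndicator (boolPair x (yt.take (p.eval x.length)))

variable {R p}

/-- `baseBit` on a well-formed string `y b₁ b₂ b₃`. [folklore] -/
theorem baseBit_append (x : List Bool) (y : Fin (p.eval x.length) → Bool) (b₁ b₂ b₃ : Bool) :
    baseBit R p x (List.ofFn y ++ [b₁, b₂, b₃]) =
      if b₁ then ((List.ofFn y).all (fun b => !b) && !b₂ && !b₃) || b₃
      else !R.boolIndicator (boolPair x (List.ofFn y)) := by
  have hl : (List.ofFn y).length = p.eval x.length := List.length_ofFn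
  have h0 : (List.ofFn y ++ [b₁, b₂, b₃]).getD (p.eval x.length) false = b₁ := by
    rw [List.getD_append_right _ _ _ _ (by omega), hl, Nat.sub_self]; rfl
  have h1 : (List.ofFn y ++ [b₁, b₂, b₃]).getD (p.eval x.length + 1) false = b₂ := by
    rw [List.getD_append_right _ _ _ _ (by omega), hl, Nat.add_sub_cancel_left]; rfl
  have h2 : (List.ofFn y ++ [b₁, b₂, b₃]).getD (p.eval x.length + 2) false = b₃ := by
    rw [List.getD_append_right _ _ _ _ (by omega), hl, Nat.add_sub_cancel_left]; rfl
  have ht : (List.ofFn y ++ [b₁, b₂, b₃]).take (p.eval x.length) = List.ofFn y := by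
    rw [List.take_append_of_le_length (by omega), List.take_of_length_le (by omega)]
  unfold baseBit
  rw [h0, h1, h2, ht]

/-- A list of bits is all-`0` iff the function it lists is constantly `false`. [folklore] -/
theorem all_not_ofFn_iff {k : ℕ} (y : Fin k → Bool) :
    (List.ofFn y).all (fun b => !b) = true ↔ y = fun _ => false := by
  rw [List.all_eq_true, List.forall_mem_ofFn_iff]
  exact ⟨fun h => funext fun i => by simpa using h i, fun h i => by simp [h]⟩

/-- The exceptional half of the base predicate: `Σ_{y b₂ b₃} (-1)^{(y = 0 ∧ ¬b₂ ∧ ¬b₃) ∨ b₃} = -2`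
(for `(y, b₂) ≠ (0, 0)` the two values of `b₃` cancel). [folklore] -/
theorem sum_sgn_exceptional (k : ℕ) :
    ∑ y : Fin k → Bool, ∑ b₂ : Bool, ∑ b₃ : Bool,
      sgn (((List.ofFn y).all (fun b => !b) && !b₂ && !b₃) || b₃) = -2 := by
  have h : ∀ (y : Fin k → Bool) (b₂ : Bool), ∑ b₃ : Bool,
      sgn (((List.ofFn y).all (fun b => !b) && !b₂ && !b₃) || b₃) =
        if y = (fun _ => false) ∧ b₂ = false then -2 else 0 := by
    intro y b₂
    by_cases hy : y = fun _ => false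
    · have ha : (List.ofFn y).all (fun b => !b) = true := (all_not_ofFn_iff y).2 hy
      cases b₂ <;> simp [hy, sgn]
    · have ha : (List.ofFn y).all (fun b => !b) = false := by
        simpa using (mt (all_not_ofFn_iff y).1 hy)
      simp [ha, hy]
  have h2 : ∀ y : Fin k → Bool, ∑ b₂ : Bool,
      (if y = (fun _ => false) ∧ b₂ = false then (-2 : ℤ) else 0) =
        if y = fun _ => false then -2 else 0 := by
    intro y; rw [Fintype.sum_bool]; by_cases hy : y = fun _ => false <;> simp [hy]
  simp_rw [h, h2]
  rw [Finset.sum_ite_eq']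
  simp

/-- **The gap of the base predicate**: `Σ_{yt ∈ {0,1}^{m+3}} (-1)^{baseBit x yt} = 2 G_x`
(`b₁ = 0`: four copies of the majority gap `2 s_x - 2^m`; `b₁ = 1`: the exceptional `-2`).
[cite: Aaronson2005, Thm. 4 (proof)] -/
theorem sum_sgn_baseBit (x : List Bool) :
    ∑ yt : Fin (p.eval x.length + 3) → Bool, sgn (baseBit R p x (List.ofFn yt)) =
      2 * gapG R p x := by
  rw [sum_fin_add]
  have hu : ∀ u : Fin (p.eval x.length) → Bool,
      ∑ w : Fin 3 → Bool, sgn (baseBit R p x (List.ofFn (Fin.append u w))) =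
        ∑ b₂ : Bool, ∑ b₃ : Bool, sgn (((List.ofFn u).all (fun b => !b) && !b₂ && !b₃) || b₃) +
          4 * sgn (!R.boolIndicator (boolPair x (List.ofFn u))) := by
    intro u
    simp_rw [List.ofFn_fin_append]
    rw [sum_fin_three (fun l => sgn (baseBit R p x (List.ofFn u ++ l)))]
    simp_rw [baseBit_append]
    rw [Fintype.sum_bool]
    simp only [Bool.false_eq_true, if_true, if_false, Finset.sum_const, Finset.card_univ,
      Fintype.card_bool, nsmul_eq_mul]
    push_cast
    ring
  simp_rw [hu]
  rw [Finset.sum_add_distrib, sum_sgn_exceptional, ← Finset.mul_sum, sum_sgn_not_boolIndicator, gapG,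
    pow_succ]
  ring

end Base

end PPPostBQP

end Literature.Computability.QuantumComplexity
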